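import Summits.KontsevichZagierPeriods.KontsevichZagierPeriods.Theses.SymplecticScissors
import Summits.KontsevichZagierPeriods.KontsevichZagierPeriods.Theorems.SymplecticScissorsVolumeFormOffPlaneSplit
import Summits.KontsevichZagierPeriods.KontsevichZagierPeriods.Theorems.SymplecticScissorsCubeNashNormalForm
import Summits.KontsevichZagierPeriods.KontsevichZagierPeriods.Theorems.VolumeFormOffPlane.Negative.Core

/-!
# Certificate (crux-strategist r1, stmt-KontsevichZagierPeriods-10042): the OTHER open binder of `closes` gives the summit ALONE

Since `CubeNashNormalForm` (stmt-3574) was PROVED (`cubeNashNormalForm_symplecticScissors_proof`, Jung's induction,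
2026-08-17) and the split glue `OffPlaneSplitGlue` (stmt-18438) is PROVED (`OffPlaneSplit.offPlaneSplitGlue_proof`), the open
crux `TypeAGeneration` (stmt-18392, Ayoub 2015 Conj. 1.1 verbatim) implies `VolumeFormOffPlane`, which IS the summit by the
landed slab ladder (`VolumeFormOffPlaneNegative.offPlane_iff_summit`). Hence `TypeAGeneration → KontsevichZagierPeriods` with NO use
of `RealOnePeriodRelations` (stmt-10042): inside route SymplecticScissors the deciding crux 10042 is load-bearing for the proof TERM of
`closes` (the `N = 2` case) but NOT for the summit — the summit-strength content of the route is 18392 alone.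
-/

open Summit.KontsevichZagierPeriods.KontsevichZagierPeriods.Theses.SymplecticScissors

namespace Summit.KontsevichZagierPeriods.KontsevichZagierPeriods.Cruxes.RealOnePeriodRelations.StrategistR1

/-- `TypeAGeneration` (stmt-18392) ALONE implies the summit, by three landed theorems. -/
theorem summit_of_typeAGeneration (hA : TypeAGeneration) : KontsevichZagierPeriods :=
  Summit.KontsevichZagierPeriods.SymplecticScissors.VolumeFormOffPlaneNegative.offPlane_iff_summit.mp
    (fun _N hN => Summit.KontsevichZagierPeriods.SymplecticScissors.OffPlaneSplit.offPlaneSplitGlue_proof hA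
      Summit.KontsevichZagierPeriods.SymplecticScissors.CubeNashNormalForm.cubeNashNormalForm_symplecticScissors_proof hN)

/-- Hence the route's deciding theorem needs only its binder `hA`: a `closes`-shaped term over `TypeAGeneration` alone
(the other four binders of the rev-28 `closes` are either proved items or, for `RealOnePeriodRelations`, unnecessary). -/
theorem closes_of_typeAGeneration_only (hR : RealOnePeriodRelations) (hA : TypeAGeneration) (hG : CubeNashNormalForm)
    (hGlue : OffPlaneSplitGlue) (hC : PlanarCompiler) : KontsevichZagierPeriods := by
  clear hR hG hGlue hC
  exact summit_of_typeAGeneration hA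

end Summit.KontsevichZagierPeriods.KontsevichZagierPeriods.Cruxes.RealOnePeriodRelations.StrategistR1
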